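import Literature.Probability.LatticeModels.TriangularIsoradialEmbedding
import Literature.Probability.LatticeModels.IsoradialSquareGrid
import HarnessLib

/-!
# The square-grid property SGP(2) of the triangular lattice (track system of the rhombille tiling)

Topic `Literature/Probability/LatticeModels`. Companion of `TriangularIsoradialEmbedding` (the
triangular lattice `𝕋 = triGraph` as an isoradial graph, `triIsoradialEmbedding`: isoradial, all
half-angles `π/6`, canonical measure critical bond percolation) and of `IsoradialSquareGrid` (the
square-grid property **as printed**, `RhombicEmbedding.IsSquareGridGM` /
`HasSquareGridPropertyGM`). We prove that `triIsoradialEmbedding` has the printed square-grid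
property of Grimmett–Manolescu, *Bond percolation on isoradial graphs*, PTRF **159** (2014)
273–327 = arXiv:1204.0505, §4.2, with parameter `I = 2`
(`isSquareGridGM_triIsoradialEmbedding`, `hasSquareGridPropertyGM_triIsoradialEmbedding`), which
completes "`𝕋 ∈ 𝒢`" (§1: "[`𝒢`] includes isoradial embeddings of the square lattice, the triangular
lattice, …"; §4.3.2: an isoradial embedding of a periodic connected graph has the square-grid
property, and "its track-set may be partitioned into `m` classes of parallel tracks").

## The argument (printed proof of §4.3.2, specialised and made explicit)

The diamond graph of `triIsoradialEmbedding` is the rhombille tiling: one rhombus per edge of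
`𝕋`, of three kinds according to the direction `1`, `ζ`, `ζ²` of the edge (`triEdge0/1/2 a b`,
normal form `exists_eq_triEdge`), whose four sides (corner–centre pairs) are listed in
`sides_triEdge0/1/2` (from `triEdgeFaces` of an explicit dart). The sides come in three parallel
classes (directions `i`, `e^{-iπ/6}`, `e^{iπ/6}` up to sign), whence three `ℤ`-indexed families
of train tracks, each alternating two kinds of rhombi, with explicit side chains:
* `triRowTrack b` (kinds `ζ`, `ζ²`; the edges between the rows `x₁ = b`, `b + 1`),
* `triColTrack a` (kinds `1`, `ζ²`; the edges between the columns `x₀ = a`, `a + 1`),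
* `triAntiTrack k` (kinds `1`, `ζ`; the edges between the antidiagonals `x₀ + x₁ = k`, `k + 1`)
(`triRowTrack_chain` etc.: the defining conditions of `RhombicEmbedding.IsTrack`).
**Classification** (`isTrack_triIsoradialEmbedding_classification`): every train track is, up to
reparametrisation (`IsReparametrization`: shift and/or reversal), one of these. Indeed each side
lies in at most two rhombi (`triIsoradialEmbedding_two_rhombi_per_side`), so a track is
determined by one rhombus and its exit side (`RhombicEmbedding.trackChain_unique`, a two-sided
induction), and for each kind of rhombus and each of its four sides a standard track, run
forwards or backwards (`trackChain_shift`, `trackChain_reverse`), leaves that rhombus through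
that side (twelve cases). The incidences between the families are explicit
(`triColTrack_eq_triRowTrack_iff`, `triAntiTrack_eq_triRowTrack_iff`,
`triAntiTrack_eq_triColTrack_iff`: two tracks of different families share exactly one rhombus,
tracks of the same family none), which gives clauses (a)–(c) of SGP(2) with `T₁` = rows,
`T₂` = columns, `S` = antidiagonals: every track outside `T_k` crosses `T_k` once per member in
index order (`crossesInOrder_triRowTrack`, `crossesInOrder_triColTrack`), and consecutive
crossings along a track are separated by exactly one rhombus (`trackBetween_triRowTrack`,
`trackBetween_triColTrack`), `1 < 2`.

## References

* G. R. Grimmett, I. Manolescu, *Bond percolation on isoradial graphs: criticality and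
  universality*, PTRF 159 (2014) 273–327, arXiv:1204.0505: §4.2 (track systems, SGP(I), the
  class `𝒢(ε, I)`), §4.3.2 (periodic graphs: the track-set splits into finitely many classes of
  parallel tracks, SGP holds), §1 (`𝒢` contains the triangular lattice).
* R. Kenyon, J.-M. Schlenker, *Rhombic embeddings of planar quad-graphs*, Trans. AMS 357
  (2005), §3 (train tracks of rhombic tilings).
* N. G. de Bruijn, *Algebraic theory of Penrose's non-periodic tilings of the plane*, Indag.
  Math. 43 (1981) (tracks as "ribbons").
-/

noncomputable section

namespace Literature.Probability.LatticeModels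

open RhombicEmbedding

/-! ### Vector bookkeeping -/

/-- Two vectors of `ℤ²` written as `![a, b]` coincide iff their entries do (local helper; cf.
`vec2_eq_iff`). [folklore] -/
private theorem vec2_inj_iff {a b c d : ℤ} : (![a, b] : Site 2) = ![c, d] ↔ a = c ∧ b = d := by
  rw [vec2_eq_iff]
  simp

/-- Extensionality for `Site 2` in coordinates (local helper). [folklore] -/
private theorem site2_eq_iff (v w : Site 2) : v = w ↔ v 0 = w 0 ∧ v 1 = w 1 := by
  constructor
  · rintro rfl; exact ⟨rfl, rfl⟩
  · rintro ⟨h0, h1⟩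
    funext i
    fin_cases i
    · exact h0
    · exact h1

/-! ### The three kinds of edges of `𝕋`, in coordinates -/

/-- The horizontal edge `{(a, b), (a + 1, b)}` of `𝕋` (direction `1`). [folklore] -/
def triEdge0 (a b : ℤ) : triGraph.edgeSet :=
  ⟨s(![a, b], ![a + 1, b]), by
    rw [SimpleGraph.mem_edgeSet]
    convert triGraph_adj_self_add_single ![a, b] 0 using 2
    exact (vec2_add_single_zero a b).symm⟩

/-- The edge `{(a, b), (a, b + 1)}` of `𝕋` (direction `ζ`). [folklore] -/
def triEdge1 (a b : ℤ) : triGraph.edgeSet :=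
  ⟨s(![a, b], ![a, b + 1]), by
    rw [SimpleGraph.mem_edgeSet]
    convert triGraph_adj_self_add_single ![a, b] 1 using 2
    exact (vec2_add_single_one a b).symm⟩

/-- `![a, b] - (1, -1) = ![a - 1, b + 1]`. [folklore] -/
theorem vec2_sub_triDiag (a b : ℤ) : (![a, b] : Site 2) - triDiag = ![a - 1, b + 1] := by
  funext i; fin_cases i <;> simp [triDiag, sub_eq_add_neg]

/-- The edge `{(a, b), (a - 1, b + 1)}` of `𝕋` (direction `ζ²`). [folklore] -/
def triEdge2 (a b : ℤ) : triGraph.edgeSet :=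
  ⟨s(![a, b], ![a - 1, b + 1]), by
    rw [SimpleGraph.mem_edgeSet]
    convert triGraph_adj_self_sub_triDiag ![a, b] using 2
    exact (vec2_sub_triDiag a b).symm⟩

/-- `triEdge0` as an unordered pair. [folklore] -/
theorem coe_triEdge0 (a b : ℤ) :
    ((triEdge0 a b : triGraph.edgeSet) : Sym2 (Site 2)) = s(![a, b], ![a + 1, b]) := rfl

/-- `triEdge1` as an unordered pair. [folklore] -/
theorem coe_triEdge1 (a b : ℤ) :
    ((triEdge1 a b : triGraph.edgeSet) : Sym2 (Site 2)) = s(![a, b], ![a, b + 1]) := rfl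

/-- `triEdge2` as an unordered pair. [folklore] -/
theorem coe_triEdge2 (a b : ℤ) :
    ((triEdge2 a b : triGraph.edgeSet) : Sym2 (Site 2)) = s(![a, b], ![a - 1, b + 1]) := rfl

/-- **Every edge of `𝕋` is a `triEdge0`, a `triEdge1` or a `triEdge2`** (the six steps of
`triGraph_adj_apply`, up to orientation). [folklore] -/
theorem exists_eq_triEdge (e : triGraph.edgeSet) :
    ∃ a b : ℤ, e = triEdge0 a b ∨ e = triEdge1 a b ∨ e = triEdge2 a b := by
  obtain ⟨e, he⟩ := e
  induction e using Sym2.ind with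
  | h x y =>
    rw [SimpleGraph.mem_edgeSet] at he
    rcases triGraph_adj_apply he with h | h | h | h | h | h
    · refine ⟨x 0, x 1, Or.inl (Subtype.ext ?_)⟩
      change s(x, y) = s(![x 0, x 1], ![x 0 + 1, x 1])
      exact Sym2.eq_iff.2 (Or.inl ⟨(vec2_eq_iff _ _ _).2 ⟨rfl, rfl⟩, (vec2_eq_iff _ _ _).2 h⟩)
    · refine ⟨x 0, x 1, Or.inr (Or.inl (Subtype.ext ?_))⟩
      change s(x, y) = s(![x 0, x 1], ![x 0, x 1 + 1])
      exact Sym2.eq_iff.2 (Or.inl ⟨(vec2_eq_iff _ _ _).2 ⟨rfl, rfl⟩, (vec2_eq_iff _ _ _).2 h⟩)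
    · refine ⟨y 0, y 1, Or.inl (Subtype.ext ?_)⟩
      change s(x, y) = s(![y 0, y 1], ![y 0 + 1, y 1])
      exact Sym2.eq_iff.2 (Or.inr ⟨(vec2_eq_iff _ _ _).2 h, (vec2_eq_iff _ _ _).2 ⟨rfl, rfl⟩⟩)
    · refine ⟨y 0, y 1, Or.inr (Or.inl (Subtype.ext ?_))⟩
      change s(x, y) = s(![y 0, y 1], ![y 0, y 1 + 1])
      exact Sym2.eq_iff.2 (Or.inr ⟨(vec2_eq_iff _ _ _).2 h, (vec2_eq_iff _ _ _).2 ⟨rfl, rfl⟩⟩)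
    · refine ⟨y 0, y 1, Or.inr (Or.inr (Subtype.ext ?_))⟩
      change s(x, y) = s(![y 0, y 1], ![y 0 - 1, y 1 + 1])
      exact Sym2.eq_iff.2 (Or.inr ⟨(vec2_eq_iff _ _ _).2 ⟨by omega, by omega⟩,
        (vec2_eq_iff _ _ _).2 ⟨rfl, rfl⟩⟩)
    · refine ⟨x 0, x 1, Or.inr (Or.inr (Subtype.ext ?_))⟩
      change s(x, y) = s(![x 0, x 1], ![x 0 - 1, x 1 + 1])
      exact Sym2.eq_iff.2 (Or.inl ⟨(vec2_eq_iff _ _ _).2 ⟨rfl, rfl⟩,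
        (vec2_eq_iff _ _ _).2 ⟨by omega, by omega⟩⟩)

/-- Symmetric invariants of an edge of `ℤ² ⊇ V(𝕋)`: the minima and maxima of the two coordinates
over its endpoints. [folklore] -/
theorem triEdge_invariants :
    ∃ m₀ m₁ M₀ M₁ : Sym2 (Site 2) → ℤ,
      (∀ a b, m₀ (triEdge0 a b) = a ∧ m₁ (triEdge0 a b) = b ∧ M₀ (triEdge0 a b) = a + 1 ∧
        M₁ (triEdge0 a b) = b) ∧
      (∀ a b, m₀ (triEdge1 a b) = a ∧ m₁ (triEdge1 a b) = b ∧ M₀ (triEdge1 a b) = a ∧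
        M₁ (triEdge1 a b) = b + 1) ∧
      (∀ a b, m₀ (triEdge2 a b) = a - 1 ∧ m₁ (triEdge2 a b) = b ∧ M₀ (triEdge2 a b) = a ∧
        M₁ (triEdge2 a b) = b + 1) := by
  refine ⟨Sym2.lift ⟨fun x y => min (x 0) (y 0), fun x y => min_comm _ _⟩,
    Sym2.lift ⟨fun x y => min (x 1) (y 1), fun x y => min_comm _ _⟩,
    Sym2.lift ⟨fun x y => max (x 0) (y 0), fun x y => max_comm _ _⟩,
    Sym2.lift ⟨fun x y => max (x 1) (y 1), fun x y => max_comm _ _⟩, ?_, ?_, ?_⟩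
  · intro a b
    rw [coe_triEdge0]
    simp only [Sym2.lift_mk, Matrix.cons_val_zero, Matrix.cons_val_one]
    omega
  · intro a b
    rw [coe_triEdge1]
    simp only [Sym2.lift_mk, Matrix.cons_val_zero, Matrix.cons_val_one]
    omega
  · intro a b
    rw [coe_triEdge2]
    simp only [Sym2.lift_mk, Matrix.cons_val_zero, Matrix.cons_val_one]
    omega

/-- `triEdge0` is injective. [folklore] -/
@[simp] theorem triEdge0_eq_triEdge0_iff {a b a' b' : ℤ} :
    triEdge0 a b = triEdge0 a' b' ↔ a = a' ∧ b = b' := by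
  obtain ⟨m₀, m₁, M₀, M₁, h0, h1, h2⟩ := triEdge_invariants
  constructor
  · intro h
    have e1 := (h0 a b).1; have e2 := (h0 a b).2.1
    rw [h, (h0 a' b').1] at e1; rw [h, (h0 a' b').2.1] at e2
    omega
  · rintro ⟨rfl, rfl⟩; rfl

/-- `triEdge1` is injective. [folklore] -/
@[simp] theorem triEdge1_eq_triEdge1_iff {a b a' b' : ℤ} :
    triEdge1 a b = triEdge1 a' b' ↔ a = a' ∧ b = b' := by
  obtain ⟨m₀, m₁, M₀, M₁, h0, h1, h2⟩ := triEdge_invariants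
  constructor
  · intro h
    have e1 := (h1 a b).1; have e2 := (h1 a b).2.1
    rw [h, (h1 a' b').1] at e1; rw [h, (h1 a' b').2.1] at e2
    omega
  · rintro ⟨rfl, rfl⟩; rfl

/-- `triEdge2` is injective. [folklore] -/
@[simp] theorem triEdge2_eq_triEdge2_iff {a b a' b' : ℤ} :
    triEdge2 a b = triEdge2 a' b' ↔ a = a' ∧ b = b' := by
  obtain ⟨m₀, m₁, M₀, M₁, h0, h1, h2⟩ := triEdge_invariants
  constructor
  · intro h
    have e1 := (h2 a b).2.2.1; have e2 := (h2 a b).2.1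
    rw [h, (h2 a' b').2.2.1] at e1; rw [h, (h2 a' b').2.1] at e2
    omega
  · rintro ⟨rfl, rfl⟩; rfl

/-- Horizontal edges are not `ζ`-edges. [folklore] -/
@[simp] theorem triEdge0_ne_triEdge1 {a b a' b' : ℤ} : triEdge0 a b ≠ triEdge1 a' b' := by
  obtain ⟨m₀, m₁, M₀, M₁, h0, h1, h2⟩ := triEdge_invariants
  intro h
  have e1 := (h0 a b).1; have e2 := (h0 a b).2.2.1
  rw [h, (h1 a' b').1] at e1; rw [h, (h1 a' b').2.2.1] at e2
  omega

/-- Horizontal edges are not `ζ²`-edges. [folklore] -/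
@[simp] theorem triEdge0_ne_triEdge2 {a b a' b' : ℤ} : triEdge0 a b ≠ triEdge2 a' b' := by
  obtain ⟨m₀, m₁, M₀, M₁, h0, h1, h2⟩ := triEdge_invariants
  intro h
  have e1 := (h0 a b).2.1; have e2 := (h0 a b).2.2.2
  rw [h, (h2 a' b').2.1] at e1; rw [h, (h2 a' b').2.2.2] at e2
  omega

/-- `ζ`-edges are not `ζ²`-edges. [folklore] -/
@[simp] theorem triEdge1_ne_triEdge2 {a b a' b' : ℤ} : triEdge1 a b ≠ triEdge2 a' b' := by
  obtain ⟨m₀, m₁, M₀, M₁, h0, h1, h2⟩ := triEdge_invariants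
  intro h
  have e1 := (h1 a b).1; have e2 := (h1 a b).2.2.1
  rw [h, (h2 a' b').1] at e1; rw [h, (h2 a' b').2.2.1] at e2
  omega

/-- `ζ`-edges are not horizontal edges. [folklore] -/
@[simp] theorem triEdge1_ne_triEdge0 {a b a' b' : ℤ} : triEdge1 a b ≠ triEdge0 a' b' :=
  fun h => triEdge0_ne_triEdge1 h.symm

/-- `ζ²`-edges are not horizontal edges. [folklore] -/
@[simp] theorem triEdge2_ne_triEdge0 {a b a' b' : ℤ} : triEdge2 a b ≠ triEdge0 a' b' :=
  fun h => triEdge0_ne_triEdge2 h.symm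

/-- `ζ²`-edges are not `ζ`-edges. [folklore] -/
@[simp] theorem triEdge2_ne_triEdge1 {a b a' b' : ℤ} : triEdge2 a b ≠ triEdge1 a' b' :=
  fun h => triEdge1_ne_triEdge2 h.symm

/-! ### The darts over the three kinds of edges and their faces -/

/-- The dart `(a, b) → (a + 1, b)`. [folklore] -/
def triDartE0 (a b : ℤ) : triGraph.Dart :=
  ⟨(![a, b], ![a + 1, b]), by
    convert triGraph_adj_self_add_single ![a, b] 0 using 2
    exact (vec2_add_single_zero a b).symm⟩

/-- The dart `(a, b) → (a, b + 1)`. [folklore] -/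
def triDartE1 (a b : ℤ) : triGraph.Dart :=
  ⟨(![a, b], ![a, b + 1]), by
    convert triGraph_adj_self_add_single ![a, b] 1 using 2
    exact (vec2_add_single_one a b).symm⟩

/-- The dart `(a, b) → (a - 1, b + 1)`. [folklore] -/
def triDartE2 (a b : ℤ) : triGraph.Dart :=
  ⟨(![a, b], ![a - 1, b + 1]), by
    convert triGraph_adj_self_sub_triDiag ![a, b] using 2
    exact (vec2_sub_triDiag a b).symm⟩

/-- `triDartE0 a b` lies over `triEdge0 a b`. [folklore] -/
theorem triDartE0_edge (a b : ℤ) : (triDartE0 a b).edge = (triEdge0 a b : Sym2 (Site 2)) := rfl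

/-- `triDartE1 a b` lies over `triEdge1 a b`. [folklore] -/
theorem triDartE1_edge (a b : ℤ) : (triDartE1 a b).edge = (triEdge1 a b : Sym2 (Site 2)) := rfl

/-- `triDartE2 a b` lies over `triEdge2 a b`. [folklore] -/
theorem triDartE2_edge (a b : ℤ) : (triDartE2 a b).edge = (triEdge2 a b : Sym2 (Site 2)) := rfl

/-- The faces of the horizontal dart `(a,b) → (a+1,b)`: left the up-triangle of the cell `(a, b)`,
right the down-triangle of the cell `(a, b-1)`. [folklore] -/
theorem triEdgeFaces_triDartE0 (a b : ℤ) :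
    triEdgeFaces (triDartE0 a b) = ((![a, b], 0), (![a, b - 1], 1)) := by
  change (triFace ![a, b] ![a + 1, b] (![a, b] + triRot60 (![a + 1, b] - ![a, b])),
    triFace ![a, b] ![a + 1, b] (![a, b] + triRotNeg60 (![a + 1, b] - ![a, b]))) = _
  have hd : (![a + 1, b] : Site 2) - ![a, b] = Pi.single 0 1 := by
    funext i; fin_cases i <;> simp
  rw [hd, ← vec2_add_single_zero]
  have h1 := triFace_add ![a, b] 0 (Pi.single 0 1) (triRot60 (Pi.single 0 1))
  have h2 := triFace_add ![a, b] 0 (Pi.single 0 1) (triRotNeg60 (Pi.single 0 1))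
  rw [add_zero] at h1 h2
  rw [h1, h2, show triFace 0 (Pi.single 0 1) (triRot60 (Pi.single 0 1)) = ((0 : Site 2), (0 : Fin 2))
      from by decide,
    show triFace 0 (Pi.single 0 1) (triRotNeg60 (Pi.single 0 1)) = (-Pi.single 1 1, (1 : Fin 2))
      from by decide]
  simp only [add_zero, Prod.mk.injEq, and_true, true_and]
  funext i; fin_cases i <;> simp [sub_eq_add_neg]

/-- The faces of the dart `(a,b) → (a,b+1)`: left the down-triangle of the cell `(a-1, b)`, right
the up-triangle of the cell `(a, b)`. [folklore] -/
theorem triEdgeFaces_triDartE1 (a b : ℤ) :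
    triEdgeFaces (triDartE1 a b) = ((![a - 1, b], 1), (![a, b], 0)) := by
  change (triFace ![a, b] ![a, b + 1] (![a, b] + triRot60 (![a, b + 1] - ![a, b])),
    triFace ![a, b] ![a, b + 1] (![a, b] + triRotNeg60 (![a, b + 1] - ![a, b]))) = _
  have hd : (![a, b + 1] : Site 2) - ![a, b] = Pi.single 1 1 := by
    funext i; fin_cases i <;> simp
  rw [hd, ← vec2_add_single_one]
  have h1 := triFace_add ![a, b] 0 (Pi.single 1 1) (triRot60 (Pi.single 1 1))
  have h2 := triFace_add ![a, b] 0 (Pi.single 1 1) (triRotNeg60 (Pi.single 1 1))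
  rw [add_zero] at h1 h2
  rw [h1, h2, show triFace 0 (Pi.single 1 1) (triRot60 (Pi.single 1 1)) = (-Pi.single 0 1, (1 : Fin 2))
      from by decide,
    show triFace 0 (Pi.single 1 1) (triRotNeg60 (Pi.single 1 1)) = ((0 : Site 2), (0 : Fin 2))
      from by decide]
  simp only [add_zero, Prod.mk.injEq, and_true]
  funext i; fin_cases i <;> simp [sub_eq_add_neg]

/-- The faces of the dart `(a,b) → (a-1,b+1)`: left the up-triangle, right the down-triangle of
the cell `(a-1, b)`. [folklore] -/
theorem triEdgeFaces_triDartE2 (a b : ℤ) :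
    triEdgeFaces (triDartE2 a b) = ((![a - 1, b], 0), (![a - 1, b], 1)) := by
  change (triFace ![a, b] ![a - 1, b + 1] (![a, b] + triRot60 (![a - 1, b + 1] - ![a, b])),
    triFace ![a, b] ![a - 1, b + 1] (![a, b] + triRotNeg60 (![a - 1, b + 1] - ![a, b]))) = _
  have hd : (![a - 1, b + 1] : Site 2) - ![a, b] = -triDiag := by
    funext i; fin_cases i <;> simp [triDiag]
  have hy : (![a - 1, b + 1] : Site 2) = ![a, b] + -triDiag := by
    rw [← sub_eq_add_neg, vec2_sub_triDiag]
  rw [hd, hy]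
  have h1 := triFace_add ![a, b] 0 (-triDiag) (triRot60 (-triDiag))
  have h2 := triFace_add ![a, b] 0 (-triDiag) (triRotNeg60 (-triDiag))
  rw [add_zero] at h1 h2
  rw [h1, h2, show triFace 0 (-triDiag) (triRot60 (-triDiag)) = (-Pi.single 0 1, (0 : Fin 2))
      from by decide,
    show triFace 0 (-triDiag) (triRotNeg60 (-triDiag)) = (-Pi.single 0 1, (1 : Fin 2))
      from by decide]
  simp only [Prod.mk.injEq, and_true]
  constructor <;> funext i <;> fin_cases i <;> simp [sub_eq_add_neg]

/-! ### The sides of the three kinds of rhombi -/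

/-- **The four sides of the rhombus of a horizontal edge** `{(a,b), (a+1,b)}`: corners
`(a, b)`, `(a + 1, b)`, face centres of the up-triangle `((a,b), 0)` above and the down-triangle
`((a,b-1), 1)` below. (Grimmett–Manolescu 2014, §2.1: the diamond graph.) [cite: GrimmettManolescu2014Isoradial, §2.1] -/
theorem sides_triEdge0 (a b : ℤ) :
    triIsoradialEmbedding.sides (triEdge0 a b) =
      {(![a, b], (![a, b], 0)), (![a + 1, b], (![a, b], 0)), (![a + 1, b], (![a, b - 1], 1)),
        (![a, b], (![a, b - 1], 1))} := by
  rw [triIsoradialEmbedding.sides_eq_dartSides triIsoradialEmbedding_isIsoradial (triDartE0_edge a b)]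
  simp only [RhombicEmbedding.dartSides, triIsoradialEmbedding_leftFace,
    triIsoradialEmbedding_rightFace, triEdgeFaces_triDartE0]
  rfl

/-- **The four sides of the rhombus of a `ζ`-edge** `{(a,b), (a,b+1)}`: face centres of the
down-triangle `((a-1,b), 1)` on the left and the up-triangle `((a,b), 0)` on the right. [cite: GrimmettManolescu2014Isoradial, §2.1] -/
theorem sides_triEdge1 (a b : ℤ) :
    triIsoradialEmbedding.sides (triEdge1 a b) =
      {(![a, b], (![a - 1, b], 1)), (![a, b + 1], (![a - 1, b], 1)), (![a, b + 1], (![a, b], 0)),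
        (![a, b], (![a, b], 0))} := by
  rw [triIsoradialEmbedding.sides_eq_dartSides triIsoradialEmbedding_isIsoradial (triDartE1_edge a b)]
  simp only [RhombicEmbedding.dartSides, triIsoradialEmbedding_leftFace,
    triIsoradialEmbedding_rightFace, triEdgeFaces_triDartE1]
  rfl

/-- **The four sides of the rhombus of a `ζ²`-edge** `{(a,b), (a-1,b+1)}`: face centres of the
up- and down-triangles of the cell `(a-1, b)`. [cite: GrimmettManolescu2014Isoradial, §2.1] -/
theorem sides_triEdge2 (a b : ℤ) :
    triIsoradialEmbedding.sides (triEdge2 a b) =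
      {(![a, b], (![a - 1, b], 0)), (![a - 1, b + 1], (![a - 1, b], 0)),
        (![a - 1, b + 1], (![a - 1, b], 1)), (![a, b], (![a - 1, b], 1))} := by
  rw [triIsoradialEmbedding.sides_eq_dartSides triIsoradialEmbedding_isIsoradial (triDartE2_edge a b)]
  simp only [RhombicEmbedding.dartSides, triIsoradialEmbedding_leftFace,
    triIsoradialEmbedding_rightFace, triEdgeFaces_triDartE2]
  rfl

/-- `(y, t) = (w, 0)` in coordinates. [folklore] -/
theorem hexVertex_eq_zero_iff {y w : Site 2} {t : Fin 2} :
    ((y, t) : HexVertex) = (w, 0) ↔ (y 0 = w 0 ∧ y 1 = w 1) ∧ (t : ℕ) = 0 := by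
  rw [Prod.mk.injEq, site2_eq_iff, Fin.ext_iff]
  rfl

/-- `(y, t) = (w, 1)` in coordinates. [folklore] -/
theorem hexVertex_eq_one_iff {y w : Site 2} {t : Fin 2} :
    ((y, t) : HexVertex) = (w, 1) ↔ (y 0 = w 0 ∧ y 1 = w 1) ∧ (t : ℕ) = 1 := by
  rw [Prod.mk.injEq, site2_eq_iff, Fin.ext_iff]
  rfl

/-- Membership in the side set of a horizontal rhombus, in coordinates. [cite: GrimmettManolescu2014Isoradial, §2.1] -/
theorem mem_sides_triEdge0_iff {a b : ℤ} {v y : Site 2} {t : Fin 2} :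
    (v, (y, t)) ∈ triIsoradialEmbedding.sides (triEdge0 a b) ↔
      (v 1 = b ∧ (v 0 = a ∨ v 0 = a + 1)) ∧
        (y 0 = a ∧ ((y 1 = b ∧ (t : ℕ) = 0) ∨ (y 1 = b - 1 ∧ (t : ℕ) = 1))) := by
  have ht := t.isLt
  rw [sides_triEdge0]
  simp only [Finset.mem_insert, Finset.mem_singleton, Prod.mk.injEq]
  simp only [site2_eq_iff, Fin.ext_iff, Matrix.cons_val_zero, Matrix.cons_val_one, Fin.val_zero,
    Fin.val_one]
  omega

/-- Membership in the side set of a `ζ`-rhombus, in coordinates. [cite: GrimmettManolescu2014Isoradial, §2.1] -/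
theorem mem_sides_triEdge1_iff {a b : ℤ} {v y : Site 2} {t : Fin 2} :
    (v, (y, t)) ∈ triIsoradialEmbedding.sides (triEdge1 a b) ↔
      (v 0 = a ∧ (v 1 = b ∨ v 1 = b + 1)) ∧
        (y 1 = b ∧ ((y 0 = a - 1 ∧ (t : ℕ) = 1) ∨ (y 0 = a ∧ (t : ℕ) = 0))) := by
  have ht := t.isLt
  rw [sides_triEdge1]
  simp only [Finset.mem_insert, Finset.mem_singleton, Prod.mk.injEq]
  simp only [site2_eq_iff, Fin.ext_iff, Matrix.cons_val_zero, Matrix.cons_val_one, Fin.val_zero,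
    Fin.val_one]
  omega

/-- Membership in the side set of a `ζ²`-rhombus, in coordinates. [cite: GrimmettManolescu2014Isoradial, §2.1] -/
theorem mem_sides_triEdge2_iff {a b : ℤ} {v y : Site 2} {t : Fin 2} :
    (v, (y, t)) ∈ triIsoradialEmbedding.sides (triEdge2 a b) ↔
      ((v 0 = a ∧ v 1 = b) ∨ (v 0 = a - 1 ∧ v 1 = b + 1)) ∧
        (y 0 = a - 1 ∧ y 1 = b ∧ ((t : ℕ) = 0 ∨ (t : ℕ) = 1)) := by
  have ht := t.isLt
  rw [sides_triEdge2]
  simp only [Finset.mem_insert, Finset.mem_singleton, Prod.mk.injEq]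
  simp only [site2_eq_iff, Fin.ext_iff, Matrix.cons_val_zero, Matrix.cons_val_one, Fin.val_zero,
    Fin.val_one]
  omega

/-- **Each side of the rhombille tiling lies in at most two rhombi**: among three rhombi with a
common side, two coincide (a side `(v, f)` lies exactly in the rhombi of the two edges of the
triangle `f` at its corner `v`). (Grimmett–Manolescu 2014, §2.1 / §4.2: each side of the diamond
graph belongs to two rhombi.) [cite: GrimmettManolescu2014Isoradial, §2.1] -/
theorem triIsoradialEmbedding_two_rhombi_per_side (p : Site 2 × HexVertex)
    (e₁ e₂ e₃ : triGraph.edgeSet) (h₁ : p ∈ triIsoradialEmbedding.sides e₁)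
    (h₂ : p ∈ triIsoradialEmbedding.sides e₂) (h₃ : p ∈ triIsoradialEmbedding.sides e₃) :
    e₁ = e₂ ∨ e₁ = e₃ ∨ e₂ = e₃ := by
  obtain ⟨v, y, t⟩ := p
  have ht := t.isLt
  obtain ⟨a₁, b₁, rfl | rfl | rfl⟩ := exists_eq_triEdge e₁ <;>
  obtain ⟨a₂, b₂, rfl | rfl | rfl⟩ := exists_eq_triEdge e₂ <;>
  obtain ⟨a₃, b₃, rfl | rfl | rfl⟩ := exists_eq_triEdge e₃ <;>
  simp only [mem_sides_triEdge0_iff, mem_sides_triEdge1_iff, mem_sides_triEdge2_iff] at h₁ h₂ h₃ <;>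
  simp only [triEdge0_eq_triEdge0_iff, triEdge1_eq_triEdge1_iff, triEdge2_eq_triEdge2_iff,
    triEdge0_ne_triEdge1, triEdge0_ne_triEdge2, triEdge1_ne_triEdge2, triEdge1_ne_triEdge0,
    triEdge2_ne_triEdge0, triEdge2_ne_triEdge1, false_or, or_false] <;>
  omega

/-! ### Generic facts on side chains of train tracks -/

namespace RhombicEmbedding

variable {V : Type*} {G : SimpleGraph V} {F : Type*} [DecidableEq V] [DecidableEq F]
  (emb : RhombicEmbedding G F)

/-- In the rhombus of a dart, the opposite of a side `p` is the side sharing neither the vertex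
nor the face of `p`. (de Bruijn 1981; Grimmett–Manolescu 2014, §2.1.) [cite: GrimmettManolescu2014Isoradial, §2.1] -/
theorem dartOppositeSide_eq_of_mem (d : G.Dart) {p q : V × F} (hp : p ∈ emb.dartSides d)
    (hq : q ∈ emb.dartSides d) (h1 : p.1 ≠ q.1) (h2 : p.2 ≠ q.2) :
    emb.dartOppositeSide d p = q := by
  have hne := d.fst_ne_snd
  obtain ⟨p1, p2⟩ := p
  obtain ⟨q1, q2⟩ := q
  simp only [RhombicEmbedding.dartSides, Finset.mem_insert, Finset.mem_singleton,
    Prod.mk.injEq] at hp hq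
  simp only [ne_eq] at h1 h2
  unfold RhombicEmbedding.dartOppositeSide
  rcases hp with ⟨rfl, rfl⟩ | ⟨rfl, rfl⟩ | ⟨rfl, rfl⟩ | ⟨rfl, rfl⟩ <;>
  rcases hq with ⟨rfl, rfl⟩ | ⟨rfl, rfl⟩ | ⟨rfl, rfl⟩ | ⟨rfl, rfl⟩ <;>
  simp_all

/-- In the rhombus of an edge, the opposite of a side `p` is the side sharing neither the vertex
nor the face of `p`. (de Bruijn 1981; Grimmett–Manolescu 2014, §2.1.) [cite: GrimmettManolescu2014Isoradial, §2.1] -/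
theorem oppositeSide_eq_of_mem {e : G.edgeSet} {p q : V × F} (hp : p ∈ emb.sides e)
    (hq : q ∈ emb.sides e) (h1 : p.1 ≠ q.1) (h2 : p.2 ≠ q.2) : emb.oppositeSide e p = q :=
  emb.dartOppositeSide_eq_of_mem (refDart e) hp hq h1 h2

/-- A shift of a side chain of a train track is a side chain of the shifted track
(Grimmett–Manolescu 2014, §4.2: a track is a doubly-infinite sequence defined up to the choice of
the starting rhombus). [cite: GrimmettManolescu2014Isoradial, §4.2] -/
theorem trackChain_shift {r : ℤ → G.edgeSet} {s : ℤ → V × F}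
    (h : ∀ n, s n ∈ emb.sides (r n) ∧ s n ∈ emb.sides (r (n + 1)) ∧ r n ≠ r (n + 1) ∧
      s n = emb.oppositeSide (r n) (s (n - 1))) (c : ℤ) :
    ∀ n, s (n + c) ∈ emb.sides (r (n + c)) ∧ s (n + c) ∈ emb.sides (r (n + 1 + c)) ∧
      r (n + c) ≠ r (n + 1 + c) ∧ s (n + c) = emb.oppositeSide (r (n + c)) (s (n - 1 + c)) := by
  intro n
  obtain ⟨h1, h2, h3, h4⟩ := h (n + c)
  rw [show n + 1 + c = n + c + 1 by ring, show n - 1 + c = n + c - 1 by ring]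
  exact ⟨h1, h2, h3, h4⟩

/-- The reversal of a side chain of a train track is a side chain of the reversed track (the
`n`-th shared side of `m ↦ r (c - m)` is the side between `r (c - n)` and `r (c - n - 1)`).
(Grimmett–Manolescu 2014, §4.2: tracks are unoriented.) [cite: GrimmettManolescu2014Isoradial, §4.2] -/
theorem trackChain_reverse {r : ℤ → G.edgeSet} {s : ℤ → V × F}
    (h : ∀ n, s n ∈ emb.sides (r n) ∧ s n ∈ emb.sides (r (n + 1)) ∧ r n ≠ r (n + 1) ∧
      s n = emb.oppositeSide (r n) (s (n - 1))) (c : ℤ) :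
    ∀ n, s (c - n - 1) ∈ emb.sides (r (c - n)) ∧ s (c - n - 1) ∈ emb.sides (r (c - (n + 1))) ∧
      r (c - n) ≠ r (c - (n + 1)) ∧
      s (c - n - 1) = emb.oppositeSide (r (c - n)) (s (c - (n - 1) - 1)) := by
  intro n
  obtain ⟨h1, h2, h3, -⟩ := h (c - n - 1)
  obtain ⟨-, -, -, h4⟩ := h (c - n)
  rw [sub_add_cancel] at h2 h3
  rw [show c - (n + 1) = c - n - 1 by ring, show c - (n - 1) - 1 = c - n by ring]
  refine ⟨h2, h1, fun h' => h3 h'.symm, ?_⟩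
  rw [h4, emb.oppositeSide_oppositeSide]

/-- **A train track is determined by one rhombus and its exit side**, in a rhombic embedding in
which every side lies in at most two rhombi: two side chains `(r, s)`, `(r', s')` with
`r 0 = r' 0` and `s 0 = s' 0` coincide. (Grimmett–Manolescu 2014, §4.2: "each rhombus belongs to
exactly two tracks", the track through a rhombus being determined by a pair of opposite sides.)
[cite: GrimmettManolescu2014Isoradial, §4.2] -/
theorem trackChain_unique
    (h2 : ∀ (p : V × F) (e₁ e₂ e₃ : G.edgeSet), p ∈ emb.sides e₁ → p ∈ emb.sides e₂ →
      p ∈ emb.sides e₃ → e₁ = e₂ ∨ e₁ = e₃ ∨ e₂ = e₃)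
    {r r' : ℤ → G.edgeSet} {s s' : ℤ → V × F}
    (hr : ∀ n, s n ∈ emb.sides (r n) ∧ s n ∈ emb.sides (r (n + 1)) ∧ r n ≠ r (n + 1) ∧
      s n = emb.oppositeSide (r n) (s (n - 1)))
    (hr' : ∀ n, s' n ∈ emb.sides (r' n) ∧ s' n ∈ emb.sides (r' (n + 1)) ∧ r' n ≠ r' (n + 1) ∧
      s' n = emb.oppositeSide (r' n) (s' (n - 1)))
    (h0 : r 0 = r' 0) (hs0 : s 0 = s' 0) (n : ℤ) : r n = r' n ∧ s n = s' n := by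
  induction n using Int.induction_on with
  | zero => exact ⟨h0, hs0⟩
  | succ i ih =>
    obtain ⟨hr_eq, hs_eq⟩ := ih
    obtain ⟨ha1, ha2, ha3, -⟩ := hr i
    obtain ⟨-, hb2, hb3, -⟩ := hr' i
    have hnext : r (i + 1) = r' (i + 1) := by
      rw [← hs_eq] at hb2
      rw [← hr_eq] at hb3
      rcases h2 (s i) (r i) (r (i + 1)) (r' (i + 1)) ha1 ha2 hb2 with h | h | h
      · exact (ha3 h).elim
      · exact (hb3 h).elim
      · exact h
    refine ⟨hnext, ?_⟩
    rw [(hr ((i : ℤ) + 1)).2.2.2, (hr' ((i : ℤ) + 1)).2.2.2, add_sub_cancel_right, hnext, hs_eq]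
  | pred i ih =>
    obtain ⟨hr_eq, hs_eq⟩ := ih
    have hs_prev : s (-(i : ℤ) - 1) = s' (-(i : ℤ) - 1) := by
      have ha := (hr (-(i : ℤ))).2.2.2
      have hb := (hr' (-(i : ℤ))).2.2.2
      have ha' : s (-(i : ℤ) - 1) = emb.oppositeSide (r (-(i : ℤ))) (s (-(i : ℤ))) := by
        rw [ha, emb.oppositeSide_oppositeSide]
      have hb' : s' (-(i : ℤ) - 1) = emb.oppositeSide (r' (-(i : ℤ))) (s' (-(i : ℤ))) := by
        rw [hb, emb.oppositeSide_oppositeSide]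
      rw [ha', hb', hr_eq, hs_eq]
    obtain ⟨ha1, ha2, ha3, -⟩ := hr (-(i : ℤ) - 1)
    obtain ⟨hb1, -, hb3, -⟩ := hr' (-(i : ℤ) - 1)
    rw [sub_add_cancel] at ha2 ha3 hb3
    refine ⟨?_, hs_prev⟩
    rw [← hs_prev] at hb1
    rw [← hr_eq] at hb3
    rcases h2 (s (-(i : ℤ) - 1)) (r (-(i : ℤ))) (r (-(i : ℤ) - 1)) (r' (-(i : ℤ) - 1)) ha2 ha1 hb1
      with h | h | h
    · exact (ha3 h.symm).elim
    · exact (hb3 h.symm).elim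
    · exact h

end RhombicEmbedding

/-- A reparametrisation of a track crossing a family in order crosses it in order (shifts
preserve, reversals exchange, increasing and decreasing crossing indices).
(Grimmett–Manolescu 2014, §4.2.) [cite: GrimmettManolescu2014Isoradial, §4.2] -/
theorem crossesInOrder_of_isReparametrization {V : Type*} {G : SimpleGraph V}
    {r t : ℤ → G.edgeSet} {fam : ℤ → ℤ → G.edgeSet} (h : IsReparametrization r t) {ψ : ℤ → ℤ}
    (hψ : StrictMono ψ ∨ StrictAnti ψ) (ht : ∀ i, meetIndices t (fam i) = {ψ i}) :
    CrossesInOrder r fam := by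
  have key : ∀ i m, (∃ n, t m = fam i n) ↔ m = ψ i := fun i m => by
    have := Set.ext_iff.1 (ht i) m
    simpa only [meetIndices, Set.mem_setOf_eq, Set.mem_singleton_iff] using this
  obtain ⟨c, h | h⟩ := h
  · refine ⟨fun i => ψ i - c, ?_, fun i => ?_⟩
    · rcases hψ with hψ | hψ
      · exact Or.inl fun i j hij => by have := hψ hij; dsimp only; omega
      · exact Or.inr fun i j hij => by have := hψ hij; dsimp only; omega
    · ext m
      simp only [meetIndices, Set.mem_setOf_eq, Set.mem_singleton_iff, h, key]
      omega
  · refine ⟨fun i => c - ψ i, ?_, fun i => ?_⟩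
    · rcases hψ with hψ | hψ
      · exact Or.inr fun i j hij => by have := hψ hij; dsimp only; omega
      · exact Or.inl fun i j hij => by have := hψ hij; dsimp only; omega
    · ext m
      simp only [meetIndices, Set.mem_setOf_eq, Set.mem_singleton_iff, h, key]
      omega

/-! ### The three families of train tracks of the rhombille tiling -/

/-- The **row track** `b` of the rhombille tiling of `𝕋` (shared sides vertical, running east):
it alternates the `ζ`-edge `{(m, b), (m, b+1)}` (index `2m`) and the `ζ²`-edge
`{(m+1, b), (m, b+1)}` (index `2m+1`), i.e. the edges joining the rows `x₁ = b` and `x₁ = b + 1`.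
(Grimmett–Manolescu 2014, §4.2 (train tracks) and §1 (the triangular lattice ∈ 𝒢).) [cite: GrimmettManolescu2014Isoradial, §4.2] -/
def triRowTrack (b : ℤ) (n : ℤ) : triGraph.edgeSet :=
  if n % 2 = 0 then triEdge1 (n / 2) b else triEdge2 (n / 2 + 1) b

/-- The side chain of `triRowTrack b`: the `n`-th shared side is (vertex `(m, b+1)`, up-face of
the cell `(m, b)`) for `n = 2m` and (vertex `(m+1, b)`, down-face of the cell `(m, b)`) for
`n = 2m+1`. [cite: GrimmettManolescu2014Isoradial, §4.2] -/
def triRowChain (b : ℤ) (n : ℤ) : Site 2 × HexVertex :=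
  if n % 2 = 0 then (![n / 2, b + 1], (![n / 2, b], 0)) else (![n / 2 + 1, b], (![n / 2, b], 1))

/-- The **column track** `a` (shared sides of direction `e^{-iπ/6}`, running in direction `ζ`):
it alternates the horizontal edge `{(a, m), (a+1, m)}` (index `2m`) and the `ζ²`-edge
`{(a+1, m), (a, m+1)}` (index `2m+1`), i.e. the edges joining the columns `x₀ = a` and
`x₀ = a + 1`. [cite: GrimmettManolescu2014Isoradial, §4.2] -/
def triColTrack (a : ℤ) (n : ℤ) : triGraph.edgeSet :=
  if n % 2 = 0 then triEdge0 a (n / 2) else triEdge2 (a + 1) (n / 2)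

/-- The side chain of `triColTrack a`. [cite: GrimmettManolescu2014Isoradial, §4.2] -/
def triColChain (a : ℤ) (n : ℤ) : Site 2 × HexVertex :=
  if n % 2 = 0 then (![a + 1, n / 2], (![a, n / 2], 0)) else (![a, n / 2 + 1], (![a, n / 2], 1))

/-- The **antidiagonal track** `k` (shared sides of direction `e^{iπ/6}`, running in direction
`ζ²`): it alternates the horizontal edge `{(k-m, m), (k-m+1, m)}` (index `2m`) and the `ζ`-edge
`{(k-m, m), (k-m, m+1)}` (index `2m+1`), i.e. the edges joining the antidiagonals `x₀ + x₁ = k`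
and `x₀ + x₁ = k + 1`. [cite: GrimmettManolescu2014Isoradial, §4.2] -/
def triAntiTrack (k : ℤ) (n : ℤ) : triGraph.edgeSet :=
  if n % 2 = 0 then triEdge0 (k - n / 2) (n / 2) else triEdge1 (k - n / 2) (n / 2)

/-- The side chain of `triAntiTrack k`. [cite: GrimmettManolescu2014Isoradial, §4.2] -/
def triAntiChain (k : ℤ) (n : ℤ) : Site 2 × HexVertex :=
  if n % 2 = 0 then (![k - n / 2, n / 2], (![k - n / 2, n / 2], 0))
  else (![k - n / 2, n / 2 + 1], (![k - n / 2 - 1, n / 2], 1))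

section ClosedForms

variable (a b k m : ℤ)

/-- `2m` is even. [folklore] -/
private theorem two_mul_emod : (2 * m) % 2 = 0 := by omega
/-- `2m / 2 = m`. [folklore] -/
private theorem two_mul_ediv : (2 * m) / 2 = m := by omega
/-- `2m + 1` is odd. [folklore] -/
private theorem two_mul_add_one_emod : (2 * m + 1) % 2 = 1 := by omega
/-- `(2m + 1) / 2 = m`. [folklore] -/
private theorem two_mul_add_one_ediv : (2 * m + 1) / 2 = m := by omega

/-- Even-indexed rhombi of a row track. [cite: GrimmettManolescu2014Isoradial, §4.2] -/
@[simp] theorem triRowTrack_two_mul : triRowTrack b (2 * m) = triEdge1 m b := by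
  unfold triRowTrack; rw [if_pos (two_mul_emod m), two_mul_ediv]

/-- Odd-indexed rhombi of a row track. [cite: GrimmettManolescu2014Isoradial, §4.2] -/
@[simp] theorem triRowTrack_two_mul_add_one : triRowTrack b (2 * m + 1) = triEdge2 (m + 1) b := by
  unfold triRowTrack; rw [if_neg (by rw [two_mul_add_one_emod]; decide), two_mul_add_one_ediv]

/-- Even-indexed sides of a row track. [cite: GrimmettManolescu2014Isoradial, §4.2] -/
@[simp] theorem triRowChain_two_mul : triRowChain b (2 * m) = (![m, b + 1], (![m, b], 0)) := by
  unfold triRowChain; rw [if_pos (two_mul_emod m), two_mul_ediv]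

/-- Odd-indexed sides of a row track. [cite: GrimmettManolescu2014Isoradial, §4.2] -/
@[simp] theorem triRowChain_two_mul_add_one :
    triRowChain b (2 * m + 1) = (![m + 1, b], (![m, b], 1)) := by
  unfold triRowChain; rw [if_neg (by rw [two_mul_add_one_emod]; decide), two_mul_add_one_ediv]

/-- Even-indexed rhombi of a column track. [cite: GrimmettManolescu2014Isoradial, §4.2] -/
@[simp] theorem triColTrack_two_mul : triColTrack a (2 * m) = triEdge0 a m := by
  unfold triColTrack; rw [if_pos (two_mul_emod m), two_mul_ediv]

/-- Odd-indexed rhombi of a column track. [cite: GrimmettManolescu2014Isoradial, §4.2] -/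
@[simp] theorem triColTrack_two_mul_add_one : triColTrack a (2 * m + 1) = triEdge2 (a + 1) m := by
  unfold triColTrack; rw [if_neg (by rw [two_mul_add_one_emod]; decide), two_mul_add_one_ediv]

/-- Even-indexed sides of a column track. [cite: GrimmettManolescu2014Isoradial, §4.2] -/
@[simp] theorem triColChain_two_mul : triColChain a (2 * m) = (![a + 1, m], (![a, m], 0)) := by
  unfold triColChain; rw [if_pos (two_mul_emod m), two_mul_ediv]

/-- Odd-indexed sides of a column track. [cite: GrimmettManolescu2014Isoradial, §4.2] -/
@[simp] theorem triColChain_two_mul_add_one :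
    triColChain a (2 * m + 1) = (![a, m + 1], (![a, m], 1)) := by
  unfold triColChain; rw [if_neg (by rw [two_mul_add_one_emod]; decide), two_mul_add_one_ediv]

/-- Even-indexed rhombi of an antidiagonal track. [cite: GrimmettManolescu2014Isoradial, §4.2] -/
@[simp] theorem triAntiTrack_two_mul : triAntiTrack k (2 * m) = triEdge0 (k - m) m := by
  unfold triAntiTrack; rw [if_pos (two_mul_emod m), two_mul_ediv]

/-- Odd-indexed rhombi of an antidiagonal track. [cite: GrimmettManolescu2014Isoradial, §4.2] -/
@[simp] theorem triAntiTrack_two_mul_add_one :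
    triAntiTrack k (2 * m + 1) = triEdge1 (k - m) m := by
  unfold triAntiTrack; rw [if_neg (by rw [two_mul_add_one_emod]; decide), two_mul_add_one_ediv]

/-- Even-indexed sides of an antidiagonal track. [cite: GrimmettManolescu2014Isoradial, §4.2] -/
@[simp] theorem triAntiChain_two_mul :
    triAntiChain k (2 * m) = (![k - m, m], (![k - m, m], 0)) := by
  unfold triAntiChain; rw [if_pos (two_mul_emod m), two_mul_ediv]

/-- Odd-indexed sides of an antidiagonal track. [cite: GrimmettManolescu2014Isoradial, §4.2] -/
@[simp] theorem triAntiChain_two_mul_add_one :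
    triAntiChain k (2 * m + 1) = (![k - m, m + 1], (![k - m - 1, m], 1)) := by
  unfold triAntiChain; rw [if_neg (by rw [two_mul_add_one_emod]; decide), two_mul_add_one_ediv]

end ClosedForms

/-- Every integer is `2m` or `2m + 1`. [folklore] -/
private theorem int_parity_cases (n : ℤ) : ∃ m, n = 2 * m ∨ n = 2 * m + 1 :=
  ⟨n / 2, by omega⟩

/-- **The row tracks are train tracks of `triIsoradialEmbedding`**, with side chain
`triRowChain`. (Grimmett–Manolescu 2014, §4.2; §1: 𝕋 ∈ 𝒢.) [cite: GrimmettManolescu2014Isoradial, §4.2] -/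
theorem triRowTrack_chain (b : ℤ) : ∀ n,
    triRowChain b n ∈ triIsoradialEmbedding.sides (triRowTrack b n) ∧
      triRowChain b n ∈ triIsoradialEmbedding.sides (triRowTrack b (n + 1)) ∧
      triRowTrack b n ≠ triRowTrack b (n + 1) ∧
      triRowChain b n = triIsoradialEmbedding.oppositeSide (triRowTrack b n) (triRowChain b (n - 1)) := by
  intro n
  obtain ⟨m, rfl | rfl⟩ := int_parity_cases n
  · rw [show 2 * m - 1 = 2 * (m - 1) + 1 by ring]
    simp only [triRowTrack_two_mul, triRowTrack_two_mul_add_one, triRowChain_two_mul,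
      triRowChain_two_mul_add_one]
    have hm1 : (![m, b + 1], (![m, b], (0 : Fin 2))) ∈ triIsoradialEmbedding.sides (triEdge1 m b) := by
      rw [mem_sides_triEdge1_iff]; simp
    have hm0 : (![m - 1 + 1, b], (![m - 1, b], (1 : Fin 2))) ∈
        triIsoradialEmbedding.sides (triEdge1 m b) := by
      rw [mem_sides_triEdge1_iff]; simp
    refine ⟨hm1, by rw [mem_sides_triEdge2_iff]; simp, triEdge1_ne_triEdge2, ?_⟩
    refine (triIsoradialEmbedding.oppositeSide_eq_of_mem hm0 hm1 ?_ ?_).symm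
    · simp only [ne_eq, vec2_inj_iff]; omega
    · exact fun h => absurd (congrArg Prod.snd h) (by simp)
  · rw [show 2 * m + 1 + 1 = 2 * (m + 1) by ring, add_sub_cancel_right]
    simp only [triRowTrack_two_mul, triRowTrack_two_mul_add_one, triRowChain_two_mul,
      triRowChain_two_mul_add_one]
    have hm1 : (![m + 1, b], (![m, b], (1 : Fin 2))) ∈
        triIsoradialEmbedding.sides (triEdge2 (m + 1) b) := by
      rw [mem_sides_triEdge2_iff]; simp
    have hm0 : (![m, b + 1], (![m, b], (0 : Fin 2))) ∈
        triIsoradialEmbedding.sides (triEdge2 (m + 1) b) := by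
      rw [mem_sides_triEdge2_iff]; simp
    refine ⟨hm1, by rw [mem_sides_triEdge1_iff]; simp, triEdge2_ne_triEdge1, ?_⟩
    refine (triIsoradialEmbedding.oppositeSide_eq_of_mem hm0 hm1 ?_ ?_).symm
    · simp only [ne_eq, vec2_inj_iff]; omega
    · exact fun h => absurd (congrArg Prod.snd h) (by simp)

/-- **The column tracks are train tracks**, with side chain `triColChain`. [cite: GrimmettManolescu2014Isoradial, §4.2] -/
theorem triColTrack_chain (a : ℤ) : ∀ n,
    triColChain a n ∈ triIsoradialEmbedding.sides (triColTrack a n) ∧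
      triColChain a n ∈ triIsoradialEmbedding.sides (triColTrack a (n + 1)) ∧
      triColTrack a n ≠ triColTrack a (n + 1) ∧
      triColChain a n = triIsoradialEmbedding.oppositeSide (triColTrack a n) (triColChain a (n - 1)) := by
  intro n
  obtain ⟨m, rfl | rfl⟩ := int_parity_cases n
  · rw [show 2 * m - 1 = 2 * (m - 1) + 1 by ring]
    simp only [triColTrack_two_mul, triColTrack_two_mul_add_one, triColChain_two_mul,
      triColChain_two_mul_add_one]
    have hm1 : (![a + 1, m], (![a, m], (0 : Fin 2))) ∈ triIsoradialEmbedding.sides (triEdge0 a m) := by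
      rw [mem_sides_triEdge0_iff]; simp
    have hm0 : (![a, m - 1 + 1], (![a, m - 1], (1 : Fin 2))) ∈
        triIsoradialEmbedding.sides (triEdge0 a m) := by
      rw [mem_sides_triEdge0_iff]; simp
    refine ⟨hm1, by rw [mem_sides_triEdge2_iff]; simp, triEdge0_ne_triEdge2, ?_⟩
    refine (triIsoradialEmbedding.oppositeSide_eq_of_mem hm0 hm1 ?_ ?_).symm
    · simp only [ne_eq, vec2_inj_iff]; omega
    · exact fun h => absurd (congrArg Prod.snd h) (by simp)
  · rw [show 2 * m + 1 + 1 = 2 * (m + 1) by ring, add_sub_cancel_right]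
    simp only [triColTrack_two_mul, triColTrack_two_mul_add_one, triColChain_two_mul,
      triColChain_two_mul_add_one]
    have hm1 : (![a, m + 1], (![a, m], (1 : Fin 2))) ∈
        triIsoradialEmbedding.sides (triEdge2 (a + 1) m) := by
      rw [mem_sides_triEdge2_iff]; simp
    have hm0 : (![a + 1, m], (![a, m], (0 : Fin 2))) ∈
        triIsoradialEmbedding.sides (triEdge2 (a + 1) m) := by
      rw [mem_sides_triEdge2_iff]; simp
    refine ⟨hm1, by rw [mem_sides_triEdge0_iff]; simp, triEdge2_ne_triEdge0, ?_⟩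
    refine (triIsoradialEmbedding.oppositeSide_eq_of_mem hm0 hm1 ?_ ?_).symm
    · simp only [ne_eq, vec2_inj_iff]; omega
    · exact fun h => absurd (congrArg Prod.snd h) (by simp)

/-- **The antidiagonal tracks are train tracks**, with side chain `triAntiChain`. [cite: GrimmettManolescu2014Isoradial, §4.2] -/
theorem triAntiTrack_chain (k : ℤ) : ∀ n,
    triAntiChain k n ∈ triIsoradialEmbedding.sides (triAntiTrack k n) ∧
      triAntiChain k n ∈ triIsoradialEmbedding.sides (triAntiTrack k (n + 1)) ∧
      triAntiTrack k n ≠ triAntiTrack k (n + 1) ∧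
      triAntiChain k n =
        triIsoradialEmbedding.oppositeSide (triAntiTrack k n) (triAntiChain k (n - 1)) := by
  intro n
  obtain ⟨m, rfl | rfl⟩ := int_parity_cases n
  · rw [show 2 * m - 1 = 2 * (m - 1) + 1 by ring]
    simp only [triAntiTrack_two_mul, triAntiTrack_two_mul_add_one, triAntiChain_two_mul,
      triAntiChain_two_mul_add_one]
    have hm1 : (![k - m, m], (![k - m, m], (0 : Fin 2))) ∈
        triIsoradialEmbedding.sides (triEdge0 (k - m) m) := by
      rw [mem_sides_triEdge0_iff]; simp
    have hm0 : (![k - (m - 1), m - 1 + 1], (![k - (m - 1) - 1, m - 1], (1 : Fin 2))) ∈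
        triIsoradialEmbedding.sides (triEdge0 (k - m) m) := by
      rw [mem_sides_triEdge0_iff]; simp; omega
    refine ⟨hm1, by rw [mem_sides_triEdge1_iff]; simp, triEdge0_ne_triEdge1, ?_⟩
    refine (triIsoradialEmbedding.oppositeSide_eq_of_mem hm0 hm1 ?_ ?_).symm
    · simp only [ne_eq, vec2_inj_iff]; omega
    · exact fun h => absurd (congrArg Prod.snd h) (by simp)
  · rw [show 2 * m + 1 + 1 = 2 * (m + 1) by ring, add_sub_cancel_right]
    simp only [triAntiTrack_two_mul, triAntiTrack_two_mul_add_one, triAntiChain_two_mul,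
      triAntiChain_two_mul_add_one]
    have hm1 : (![k - m, m + 1], (![k - m - 1, m], (1 : Fin 2))) ∈
        triIsoradialEmbedding.sides (triEdge1 (k - m) m) := by
      rw [mem_sides_triEdge1_iff]; simp
    have hm0 : (![k - m, m], (![k - m, m], (0 : Fin 2))) ∈
        triIsoradialEmbedding.sides (triEdge1 (k - m) m) := by
      rw [mem_sides_triEdge1_iff]; simp
    refine ⟨hm1, by rw [mem_sides_triEdge0_iff]; simp; omega, triEdge1_ne_triEdge0, ?_⟩
    refine (triIsoradialEmbedding.oppositeSide_eq_of_mem hm0 hm1 ?_ ?_).symm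
    · simp only [ne_eq, vec2_inj_iff]; omega
    · exact fun h => absurd (congrArg Prod.snd h) (by simp)

/-- Row tracks are train tracks. [cite: GrimmettManolescu2014Isoradial, §4.2] -/
theorem isTrack_triRowTrack (b : ℤ) : triIsoradialEmbedding.IsTrack (triRowTrack b) :=
  ⟨triRowChain b, triRowTrack_chain b⟩

/-- Column tracks are train tracks. [cite: GrimmettManolescu2014Isoradial, §4.2] -/
theorem isTrack_triColTrack (a : ℤ) : triIsoradialEmbedding.IsTrack (triColTrack a) :=
  ⟨triColChain a, triColTrack_chain a⟩

/-- Antidiagonal tracks are train tracks. [cite: GrimmettManolescu2014Isoradial, §4.2] -/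
theorem isTrack_triAntiTrack (k : ℤ) : triIsoradialEmbedding.IsTrack (triAntiTrack k) :=
  ⟨triAntiChain k, triAntiTrack_chain k⟩

/-! ### Incidences between the three families -/

/-- Row tracks are injectively parametrised. [cite: GrimmettManolescu2014Isoradial, §4.2] -/
theorem triRowTrack_eq_triRowTrack_iff {b m b' m' : ℤ} :
    triRowTrack b m = triRowTrack b' m' ↔ b = b' ∧ m = m' := by
  obtain ⟨i, rfl | rfl⟩ := int_parity_cases m <;> obtain ⟨j, rfl | rfl⟩ := int_parity_cases m' <;>
    simp only [triRowTrack_two_mul, triRowTrack_two_mul_add_one, triEdge1_eq_triEdge1_iff,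
      triEdge2_eq_triEdge2_iff, triEdge1_ne_triEdge2, triEdge2_ne_triEdge1, false_iff, not_and] <;>
    omega

/-- Column tracks are injectively parametrised. [cite: GrimmettManolescu2014Isoradial, §4.2] -/
theorem triColTrack_eq_triColTrack_iff {a m a' m' : ℤ} :
    triColTrack a m = triColTrack a' m' ↔ a = a' ∧ m = m' := by
  obtain ⟨i, rfl | rfl⟩ := int_parity_cases m <;> obtain ⟨j, rfl | rfl⟩ := int_parity_cases m' <;>
    simp only [triColTrack_two_mul, triColTrack_two_mul_add_one, triEdge0_eq_triEdge0_iff,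
      triEdge2_eq_triEdge2_iff, triEdge0_ne_triEdge2, triEdge2_ne_triEdge0, false_iff, not_and] <;>
    omega

/-- Antidiagonal tracks are injectively parametrised. [cite: GrimmettManolescu2014Isoradial, §4.2] -/
theorem triAntiTrack_eq_triAntiTrack_iff {k m k' m' : ℤ} :
    triAntiTrack k m = triAntiTrack k' m' ↔ k = k' ∧ m = m' := by
  obtain ⟨i, rfl | rfl⟩ := int_parity_cases m <;> obtain ⟨j, rfl | rfl⟩ := int_parity_cases m' <;>
    simp only [triAntiTrack_two_mul, triAntiTrack_two_mul_add_one, triEdge0_eq_triEdge0_iff,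
      triEdge1_eq_triEdge1_iff, triEdge0_ne_triEdge1, triEdge1_ne_triEdge0, false_iff, not_and] <;>
    omega

/-- **A column track meets a row track exactly once**: `triColTrack a` and `triRowTrack b` share
exactly the `ζ²`-rhombus `{(a+1, b), (a, b+1)}`, at index `2b+1` of the column track and
`2a+1` of the row track. [cite: GrimmettManolescu2014Isoradial, §4.2] -/
theorem triColTrack_eq_triRowTrack_iff {a b m n : ℤ} :
    triColTrack a m = triRowTrack b n ↔ m = 2 * b + 1 ∧ n = 2 * a + 1 := by
  obtain ⟨i, rfl | rfl⟩ := int_parity_cases m <;> obtain ⟨j, rfl | rfl⟩ := int_parity_cases n <;>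
    simp only [triColTrack_two_mul, triColTrack_two_mul_add_one, triRowTrack_two_mul,
      triRowTrack_two_mul_add_one, triEdge0_ne_triEdge1, triEdge0_ne_triEdge2,
      triEdge2_ne_triEdge1, triEdge2_eq_triEdge2_iff, false_iff, not_and] <;>
    omega

/-- **An antidiagonal track meets a row track exactly once**: `triAntiTrack k` and
`triRowTrack b` share exactly the `ζ`-rhombus `{(k-b, b), (k-b, b+1)}`, at index `2b+1` of the
antidiagonal track and `2(k-b)` of the row track. [cite: GrimmettManolescu2014Isoradial, §4.2] -/
theorem triAntiTrack_eq_triRowTrack_iff {k b m n : ℤ} :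
    triAntiTrack k m = triRowTrack b n ↔ m = 2 * b + 1 ∧ n = 2 * (k - b) := by
  obtain ⟨i, rfl | rfl⟩ := int_parity_cases m <;> obtain ⟨j, rfl | rfl⟩ := int_parity_cases n <;>
    simp only [triAntiTrack_two_mul, triAntiTrack_two_mul_add_one, triRowTrack_two_mul,
      triRowTrack_two_mul_add_one, triEdge0_ne_triEdge1, triEdge0_ne_triEdge2,
      triEdge1_ne_triEdge2, triEdge1_eq_triEdge1_iff, false_iff, not_and] <;>
    omega

/-- **An antidiagonal track meets a column track exactly once**: `triAntiTrack k` and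
`triColTrack a` share exactly the horizontal rhombus `{(a, k-a), (a+1, k-a)}`, at index
`2(k-a)` of both. [cite: GrimmettManolescu2014Isoradial, §4.2] -/
theorem triAntiTrack_eq_triColTrack_iff {k a m n : ℤ} :
    triAntiTrack k m = triColTrack a n ↔ m = 2 * (k - a) ∧ n = 2 * (k - a) := by
  obtain ⟨i, rfl | rfl⟩ := int_parity_cases m <;> obtain ⟨j, rfl | rfl⟩ := int_parity_cases n <;>
    simp only [triAntiTrack_two_mul, triAntiTrack_two_mul_add_one, triColTrack_two_mul,
      triColTrack_two_mul_add_one, triEdge0_ne_triEdge2, triEdge1_ne_triEdge0,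
      triEdge1_ne_triEdge2, triEdge0_eq_triEdge0_iff, false_iff, not_and] <;>
    omega

/-- The indices at which a column track meets a row track. [cite: GrimmettManolescu2014Isoradial, §4.2] -/
theorem meetIndices_triColTrack_triRowTrack (a b : ℤ) :
    meetIndices (triColTrack a) (triRowTrack b) = {2 * b + 1} := by
  ext m
  simp only [meetIndices, Set.mem_setOf_eq, Set.mem_singleton_iff, triColTrack_eq_triRowTrack_iff]
  exact ⟨fun ⟨_, h, _⟩ => h, fun h => ⟨2 * a + 1, h, rfl⟩⟩

/-- The indices at which a row track meets a column track. [cite: GrimmettManolescu2014Isoradial, §4.2] -/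
theorem meetIndices_triRowTrack_triColTrack (b a : ℤ) :
    meetIndices (triRowTrack b) (triColTrack a) = {2 * a + 1} := by
  ext n
  simp only [meetIndices, Set.mem_setOf_eq, Set.mem_singleton_iff]
  constructor
  · rintro ⟨m, h⟩
    exact (triColTrack_eq_triRowTrack_iff.1 h.symm).2
  · rintro rfl
    exact ⟨2 * b + 1, (triColTrack_eq_triRowTrack_iff.2 ⟨rfl, rfl⟩).symm⟩

/-- The indices at which an antidiagonal track meets a row track. [cite: GrimmettManolescu2014Isoradial, §4.2] -/
theorem meetIndices_triAntiTrack_triRowTrack (k b : ℤ) :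
    meetIndices (triAntiTrack k) (triRowTrack b) = {2 * b + 1} := by
  ext m
  simp only [meetIndices, Set.mem_setOf_eq, Set.mem_singleton_iff, triAntiTrack_eq_triRowTrack_iff]
  exact ⟨fun ⟨_, h, _⟩ => h, fun h => ⟨2 * (k - b), h, rfl⟩⟩

/-- The indices at which an antidiagonal track meets a column track. [cite: GrimmettManolescu2014Isoradial, §4.2] -/
theorem meetIndices_triAntiTrack_triColTrack (k a : ℤ) :
    meetIndices (triAntiTrack k) (triColTrack a) = {2 * (k - a)} := by
  ext m
  simp only [meetIndices, Set.mem_setOf_eq, Set.mem_singleton_iff, triAntiTrack_eq_triColTrack_iff]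
  exact ⟨fun ⟨_, h, _⟩ => h, fun h => ⟨2 * (k - a), h, rfl⟩⟩

/-- Distinct row tracks do not meet. [cite: GrimmettManolescu2014Isoradial, §4.2] -/
theorem not_trackMeets_triRowTrack {b b' : ℤ} (h : b ≠ b') :
    ¬ trackMeets (triRowTrack b) (triRowTrack b') := by
  rintro ⟨m, n, hmn⟩
  exact h (triRowTrack_eq_triRowTrack_iff.1 hmn).1

/-- Distinct column tracks do not meet. [cite: GrimmettManolescu2014Isoradial, §4.2] -/
theorem not_trackMeets_triColTrack {a a' : ℤ} (h : a ≠ a') :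
    ¬ trackMeets (triColTrack a) (triColTrack a') := by
  rintro ⟨m, n, hmn⟩
  exact h (triColTrack_eq_triColTrack_iff.1 hmn).1

/-- No column track is (a reparametrisation of) a row track: the horizontal rhombus
`triColTrack a 0` lies on no row track. [cite: GrimmettManolescu2014Isoradial, §4.2] -/
theorem not_isReparametrization_triColTrack_triRowTrack (a b : ℤ) :
    ¬ IsReparametrization (triColTrack a) (triRowTrack b) := by
  intro h
  obtain ⟨n, hn⟩ := h.exists_eq 0
  have := (triColTrack_eq_triRowTrack_iff.1 hn).1
  omega

/-- No antidiagonal track is a row track. [cite: GrimmettManolescu2014Isoradial, §4.2] -/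
theorem not_isReparametrization_triAntiTrack_triRowTrack (k b : ℤ) :
    ¬ IsReparametrization (triAntiTrack k) (triRowTrack b) := by
  intro h
  obtain ⟨n, hn⟩ := h.exists_eq 0
  have := (triAntiTrack_eq_triRowTrack_iff.1 hn).1
  omega

/-- No antidiagonal track is a column track. [cite: GrimmettManolescu2014Isoradial, §4.2] -/
theorem not_isReparametrization_triAntiTrack_triColTrack (k a : ℤ) :
    ¬ IsReparametrization (triAntiTrack k) (triColTrack a) := by
  intro h
  obtain ⟨n, hn⟩ := h.exists_eq 1
  have := (triAntiTrack_eq_triColTrack_iff.1 hn).1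
  omega

/-! ### Classification of the train tracks of the rhombille tiling -/

/-- **Classification of the tracks of the isoradial triangular lattice.** Every train track of
`triIsoradialEmbedding` is, up to reparametrisation (shift and/or reversal), a row track, a
column track or an antidiagonal track: the track is determined by its rhombus `r 0` and its exit
side `s 0` (`trackChain_unique`, each side lying in two rhombi only), and for each of the three
kinds of rhombi and each of its four sides one of the standard tracks, run forwards or
backwards, leaves that rhombus through that side. (Grimmett–Manolescu 2014, §4.2–4.3: the
track system of a periodic isoradial graph; for the rhombille tiling it consists of three
parallel families.) [cite: GrimmettManolescu2014Isoradial, §4.2] -/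
theorem isTrack_triIsoradialEmbedding_classification {r : ℤ → triGraph.edgeSet}
    (hr : triIsoradialEmbedding.IsTrack r) :
    (∃ b, IsReparametrization r (triRowTrack b)) ∨ (∃ a, IsReparametrization r (triColTrack a)) ∨
      ∃ k, IsReparametrization r (triAntiTrack k) := by
  obtain ⟨s, hs⟩ := hr
  have U : ∀ {r' : ℤ → triGraph.edgeSet} {s' : ℤ → Site 2 × HexVertex},
      (∀ n, s' n ∈ triIsoradialEmbedding.sides (r' n) ∧ s' n ∈ triIsoradialEmbedding.sides (r' (n + 1)) ∧
        r' n ≠ r' (n + 1) ∧ s' n = triIsoradialEmbedding.oppositeSide (r' n) (s' (n - 1))) →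
      r 0 = r' 0 → s 0 = s' 0 → ∀ n, r n = r' n ∧ s n = s' n := fun hr' h0 hs0 n =>
    triIsoradialEmbedding.trackChain_unique triIsoradialEmbedding_two_rhombi_per_side hs hr' h0 hs0 n
  obtain ⟨a, b, h0 | h0 | h0⟩ := exists_eq_triEdge (r 0)
  · -- `r 0` is the horizontal rhombus `{(a,b), (a+1,b)}`
    have hmem := (hs 0).1
    rw [h0, sides_triEdge0] at hmem
    simp only [Finset.mem_insert, Finset.mem_singleton] at hmem
    rcases hmem with h1 | h1 | h1 | h1
    · -- exit through (vertex `(a,b)`, up-face `(a,b)`): antidiagonal track `a+b`, forwards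
      refine Or.inr (Or.inr ⟨a + b, 2 * b, Or.inl fun n =>
        (U (triIsoradialEmbedding.trackChain_shift (triAntiTrack_chain (a + b)) (2 * b)) ?_ ?_ n).1⟩)
      · show r 0 = triAntiTrack (a + b) (0 + 2 * b)
        rw [h0, zero_add, triAntiTrack_two_mul, triEdge0_eq_triEdge0_iff]; omega
      · show s 0 = triAntiChain (a + b) (0 + 2 * b)
        rw [h1, zero_add, triAntiChain_two_mul]
        simp only [Prod.mk.injEq, vec2_inj_iff, and_true]; omega
    · -- exit through (vertex `(a+1,b)`, up-face `(a,b)`): column track `a`, forwards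
      refine Or.inr (Or.inl ⟨a, 2 * b, Or.inl fun n =>
        (U (triIsoradialEmbedding.trackChain_shift (triColTrack_chain a) (2 * b)) ?_ ?_ n).1⟩)
      · show r 0 = triColTrack a (0 + 2 * b)
        rw [h0, zero_add, triColTrack_two_mul]
      · show s 0 = triColChain a (0 + 2 * b)
        rw [h1, zero_add, triColChain_two_mul]
    · -- exit through (vertex `(a+1,b)`, down-face `(a,b-1)`): antidiagonal track, backwards
      refine Or.inr (Or.inr ⟨a + b, 2 * b, Or.inr fun n =>
        (U (triIsoradialEmbedding.trackChain_reverse (triAntiTrack_chain (a + b)) (2 * b)) ?_ ?_ n).1⟩)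
      · show r 0 = triAntiTrack (a + b) (2 * b - 0)
        rw [h0, sub_zero, triAntiTrack_two_mul, triEdge0_eq_triEdge0_iff]; omega
      · show s 0 = triAntiChain (a + b) (2 * b - 0 - 1)
        rw [h1, show (2 * b - 0 - 1 : ℤ) = 2 * (b - 1) + 1 by ring, triAntiChain_two_mul_add_one]
        simp only [Prod.mk.injEq, vec2_inj_iff, and_true]; omega
    · -- exit through (vertex `(a,b)`, down-face `(a,b-1)`): column track `a`, backwards
      refine Or.inr (Or.inl ⟨a, 2 * b, Or.inr fun n =>
        (U (triIsoradialEmbedding.trackChain_reverse (triColTrack_chain a) (2 * b)) ?_ ?_ n).1⟩)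
      · show r 0 = triColTrack a (2 * b - 0)
        rw [h0, sub_zero, triColTrack_two_mul]
      · show s 0 = triColChain a (2 * b - 0 - 1)
        rw [h1, show (2 * b - 0 - 1 : ℤ) = 2 * (b - 1) + 1 by ring, triColChain_two_mul_add_one]
        simp only [Prod.mk.injEq, vec2_inj_iff, true_and, and_true]; omega
  · -- `r 0` is the `ζ`-rhombus `{(a,b), (a,b+1)}`
    have hmem := (hs 0).1
    rw [h0, sides_triEdge1] at hmem
    simp only [Finset.mem_insert, Finset.mem_singleton] at hmem
    rcases hmem with h1 | h1 | h1 | h1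
    · -- exit through (vertex `(a,b)`, down-face `(a-1,b)`): row track `b`, backwards
      refine Or.inl ⟨b, 2 * a, Or.inr fun n =>
        (U (triIsoradialEmbedding.trackChain_reverse (triRowTrack_chain b) (2 * a)) ?_ ?_ n).1⟩
      · show r 0 = triRowTrack b (2 * a - 0)
        rw [h0, sub_zero, triRowTrack_two_mul]
      · show s 0 = triRowChain b (2 * a - 0 - 1)
        rw [h1, show (2 * a - 0 - 1 : ℤ) = 2 * (a - 1) + 1 by ring, triRowChain_two_mul_add_one]
        simp only [Prod.mk.injEq, vec2_inj_iff, and_true]; omega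
    · -- exit through (vertex `(a,b+1)`, down-face `(a-1,b)`): antidiagonal track, forwards
      refine Or.inr (Or.inr ⟨a + b, 2 * b + 1, Or.inl fun n =>
        (U (triIsoradialEmbedding.trackChain_shift (triAntiTrack_chain (a + b)) (2 * b + 1)) ?_ ?_ n).1⟩)
      · show r 0 = triAntiTrack (a + b) (0 + (2 * b + 1))
        rw [h0, zero_add, triAntiTrack_two_mul_add_one, triEdge1_eq_triEdge1_iff]; omega
      · show s 0 = triAntiChain (a + b) (0 + (2 * b + 1))
        rw [h1, zero_add, triAntiChain_two_mul_add_one]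
        simp only [Prod.mk.injEq, vec2_inj_iff, and_true]; omega
    · -- exit through (vertex `(a,b+1)`, up-face `(a,b)`): row track `b`, forwards
      refine Or.inl ⟨b, 2 * a, Or.inl fun n =>
        (U (triIsoradialEmbedding.trackChain_shift (triRowTrack_chain b) (2 * a)) ?_ ?_ n).1⟩
      · show r 0 = triRowTrack b (0 + 2 * a)
        rw [h0, zero_add, triRowTrack_two_mul]
      · show s 0 = triRowChain b (0 + 2 * a)
        rw [h1, zero_add, triRowChain_two_mul]
    · -- exit through (vertex `(a,b)`, up-face `(a,b)`): antidiagonal track, backwards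
      refine Or.inr (Or.inr ⟨a + b, 2 * b + 1, Or.inr fun n =>
        (U (triIsoradialEmbedding.trackChain_reverse (triAntiTrack_chain (a + b)) (2 * b + 1)) ?_ ?_ n).1⟩)
      · show r 0 = triAntiTrack (a + b) (2 * b + 1 - 0)
        rw [h0, sub_zero, triAntiTrack_two_mul_add_one, triEdge1_eq_triEdge1_iff]; omega
      · show s 0 = triAntiChain (a + b) (2 * b + 1 - 0 - 1)
        rw [h1, sub_zero, add_sub_cancel_right, triAntiChain_two_mul]
        simp only [Prod.mk.injEq, vec2_inj_iff, and_true]; omega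
  · -- `r 0` is the `ζ²`-rhombus `{(a,b), (a-1,b+1)}`
    have hmem := (hs 0).1
    rw [h0, sides_triEdge2] at hmem
    simp only [Finset.mem_insert, Finset.mem_singleton] at hmem
    rcases hmem with h1 | h1 | h1 | h1
    · -- exit through (vertex `(a,b)`, up-face `(a-1,b)`): column track `a-1`, backwards
      refine Or.inr (Or.inl ⟨a - 1, 2 * b + 1, Or.inr fun n =>
        (U (triIsoradialEmbedding.trackChain_reverse (triColTrack_chain (a - 1)) (2 * b + 1)) ?_ ?_ n).1⟩)
      · show r 0 = triColTrack (a - 1) (2 * b + 1 - 0)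
        rw [h0, sub_zero, triColTrack_two_mul_add_one, triEdge2_eq_triEdge2_iff]; omega
      · show s 0 = triColChain (a - 1) (2 * b + 1 - 0 - 1)
        rw [h1, sub_zero, add_sub_cancel_right, triColChain_two_mul]
        simp only [Prod.mk.injEq, vec2_inj_iff, and_true]; omega
    · -- exit through (vertex `(a-1,b+1)`, up-face `(a-1,b)`): row track `b`, backwards
      refine Or.inl ⟨b, 2 * a - 1, Or.inr fun n =>
        (U (triIsoradialEmbedding.trackChain_reverse (triRowTrack_chain b) (2 * a - 1)) ?_ ?_ n).1⟩
      · show r 0 = triRowTrack b (2 * a - 1 - 0)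
        rw [h0, show (2 * a - 1 - 0 : ℤ) = 2 * (a - 1) + 1 by ring, triRowTrack_two_mul_add_one,
          triEdge2_eq_triEdge2_iff]; omega
      · show s 0 = triRowChain b (2 * a - 1 - 0 - 1)
        rw [h1, show (2 * a - 1 - 0 - 1 : ℤ) = 2 * (a - 1) by ring, triRowChain_two_mul]
    · -- exit through (vertex `(a-1,b+1)`, down-face `(a-1,b)`): column track `a-1`, forwards
      refine Or.inr (Or.inl ⟨a - 1, 2 * b + 1, Or.inl fun n =>
        (U (triIsoradialEmbedding.trackChain_shift (triColTrack_chain (a - 1)) (2 * b + 1)) ?_ ?_ n).1⟩)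
      · show r 0 = triColTrack (a - 1) (0 + (2 * b + 1))
        rw [h0, zero_add, triColTrack_two_mul_add_one, triEdge2_eq_triEdge2_iff]; omega
      · show s 0 = triColChain (a - 1) (0 + (2 * b + 1))
        rw [h1, zero_add, triColChain_two_mul_add_one]
    · -- exit through (vertex `(a,b)`, down-face `(a-1,b)`): row track `b`, forwards
      refine Or.inl ⟨b, 2 * a - 1, Or.inl fun n =>
        (U (triIsoradialEmbedding.trackChain_shift (triRowTrack_chain b) (2 * a - 1)) ?_ ?_ n).1⟩
      · show r 0 = triRowTrack b (0 + (2 * a - 1))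
        rw [h0, show (0 + (2 * a - 1) : ℤ) = 2 * (a - 1) + 1 by ring, triRowTrack_two_mul_add_one,
          triEdge2_eq_triEdge2_iff]; omega
      · show s 0 = triRowChain b (0 + (2 * a - 1))
        rw [h1, show (0 + (2 * a - 1) : ℤ) = 2 * (a - 1) + 1 by ring, triRowChain_two_mul_add_one]
        simp only [Prod.mk.injEq, vec2_inj_iff, and_true]; omega

/-- **The track system of `𝕋` consists of the three parallel families**: a track that is neither
a row track nor a column track (up to reparametrisation) is an antidiagonal track.
(Grimmett–Manolescu 2014, §4.2; here `S` = antidiagonal tracks, `T₁` = rows, `T₂` = columns.) [cite: GrimmettManolescu2014Isoradial, §4.2] -/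
theorem isReparametrization_triAntiTrack_of_not {r : ℤ → triGraph.edgeSet}
    (hr : triIsoradialEmbedding.IsTrack r) (hrow : ∀ b, ¬ IsReparametrization r (triRowTrack b))
    (hcol : ∀ a, ¬ IsReparametrization r (triColTrack a)) :
    ∃ k, IsReparametrization r (triAntiTrack k) := by
  rcases isTrack_triIsoradialEmbedding_classification hr with ⟨b, hb⟩ | ⟨a, ha⟩ | h
  · exact (hrow b hb).elim
  · exact (hcol a ha).elim
  · exact h

/-! ### The square grid of `𝕋` -/

/-- **Every track that is not a row track crosses the rows in order, once each.** By the
classification it is a column track (meeting `triRowTrack b` exactly at its index `2b+1`) or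
an antidiagonal track (likewise), up to reparametrisation. (Grimmett–Manolescu 2014, §4.2 (b).) [cite: GrimmettManolescu2014Isoradial, §4.2] -/
theorem crossesInOrder_triRowTrack {r : ℤ → triGraph.edgeSet} (hr : triIsoradialEmbedding.IsTrack r)
    (hpar : ∀ b, ¬ IsReparametrization r (triRowTrack b)) : CrossesInOrder r triRowTrack := by
  have hmono : StrictMono fun b : ℤ => 2 * b + 1 := fun i j hij => by dsimp only; omega
  rcases isTrack_triIsoradialEmbedding_classification hr with ⟨b, hb⟩ | ⟨a, ha⟩ | ⟨k, hk⟩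
  · exact (hpar b hb).elim
  · exact crossesInOrder_of_isReparametrization ha (Or.inl hmono)
      (meetIndices_triColTrack_triRowTrack a)
  · exact crossesInOrder_of_isReparametrization hk (Or.inl hmono)
      (meetIndices_triAntiTrack_triRowTrack k)

/-- **Every track that is not a column track crosses the columns in order, once each.**
(Grimmett–Manolescu 2014, §4.2 (b).) [cite: GrimmettManolescu2014Isoradial, §4.2] -/
theorem crossesInOrder_triColTrack {r : ℤ → triGraph.edgeSet} (hr : triIsoradialEmbedding.IsTrack r)
    (hpar : ∀ a, ¬ IsReparametrization r (triColTrack a)) : CrossesInOrder r triColTrack := by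
  rcases isTrack_triIsoradialEmbedding_classification hr with ⟨b, hb⟩ | ⟨a, ha⟩ | ⟨k, hk⟩
  · exact crossesInOrder_of_isReparametrization hb
      (Or.inl (fun i j hij => by dsimp only; omega : StrictMono fun a : ℤ => 2 * a + 1))
      (meetIndices_triRowTrack_triColTrack b)
  · exact (hpar a ha).elim
  · exact crossesInOrder_of_isReparametrization hk
      (Or.inr (fun i j hij => by dsimp only; omega : StrictAnti fun a : ℤ => 2 * (k - a)))
      (meetIndices_triAntiTrack_triColTrack k)

/-- Between consecutive columns a row track has exactly one rhombus. [cite: GrimmettManolescu2014Isoradial, §4.2] -/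
theorem trackBetween_triRowTrack (b a : ℤ) :
    trackBetween (triRowTrack b) (triColTrack a) (triColTrack (a + 1)) = {2 * a + 2} := by
  ext n
  simp only [trackBetween, meetIndices_triRowTrack_triColTrack, Set.mem_singleton_iff,
    exists_eq_left, Set.mem_setOf_eq]
  omega

/-- Between consecutive rows a column track has exactly one rhombus. [cite: GrimmettManolescu2014Isoradial, §4.2] -/
theorem trackBetween_triColTrack (a b : ℤ) :
    trackBetween (triColTrack a) (triRowTrack b) (triRowTrack (b + 1)) = {2 * b + 2} := by
  ext n
  simp only [trackBetween, meetIndices_triColTrack_triRowTrack, Set.mem_singleton_iff,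
    exists_eq_left, Set.mem_setOf_eq]
  omega

/-- **The rows and columns of the rhombille tiling form a square grid of `𝕋` in the printed
sense of Grimmett–Manolescu, with `I = 2`**: `T₁` = the row tracks (shared sides vertical),
`T₂` = the column tracks (shared sides of direction `e^{-iπ/6}`), `S` = the antidiagonal tracks;
(a) each family consists of simple, pairwise non-meeting tracks; (b) every other track — by the
classification `isTrack_triIsoradialEmbedding_classification`, a member of one of the other two
families — crosses each track of the family exactly once, in index order; (c) consecutive
crossings along a track are separated by exactly one rhombus, `1 < 2`.
(Grimmett–Manolescu 2014, §4.2 (SGP(I)) and §1: "[`𝒢`] includes … the triangular … lattice".) [cite: GrimmettManolescu2014Isoradial, §4.2 (SGP(I)); §1 (𝒢 ∋ triangular lattice)] -/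
theorem isSquareGridGM_triIsoradialEmbedding :
    triIsoradialEmbedding.IsSquareGridGM triRowTrack triColTrack 2 where
  isSimpleTrack_left b := ⟨isTrack_triRowTrack b, fun m m' h => (triRowTrack_eq_triRowTrack_iff.1 h).2⟩
  isSimpleTrack_right a := ⟨isTrack_triColTrack a, fun m m' h => (triColTrack_eq_triColTrack_iff.1 h).2⟩
  pairwise_not_trackMeets_left _ _ h := not_trackMeets_triRowTrack h
  pairwise_not_trackMeets_right _ _ h := not_trackMeets_triColTrack h
  not_isReparametrization b a := not_isReparametrization_triColTrack_triRowTrack a b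
  crossesInOrder_left _ hr hpar := crossesInOrder_triRowTrack hr hpar
  crossesInOrder_right _ hr hpar := crossesInOrder_triColTrack hr hpar
  encard_trackBetween_left_lt b a := by
    rw [trackBetween_triRowTrack, Set.encard_singleton]; norm_num
  encard_trackBetween_right_lt a b := by
    rw [trackBetween_triColTrack, Set.encard_singleton]; norm_num

/-- `𝕋` satisfies SGP(2). [cite: GrimmettManolescu2014Isoradial, §4.2] -/
theorem squareGridPropertyGM_triIsoradialEmbedding : triIsoradialEmbedding.SquareGridPropertyGM 2 :=
  ⟨_, _, isSquareGridGM_triIsoradialEmbedding⟩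

/-- **The isoradial triangular lattice has the square-grid property in the printed sense of
Grimmett–Manolescu** (so `𝕋 ∈ 𝒢`, together with `triIsoradialEmbedding_isIsoradial`,
`triIsoradialEmbedding_hasBoundedAngles` and the rhombic-tiling property of
`Literature.Probability.Percolation.TriangularIsoradialTiling`).
(Grimmett–Manolescu 2014, §1 and §4.2.) [cite: GrimmettManolescu2014Isoradial, §4.2 (SGP); §1 (𝒢 ∋ triangular lattice)] -/
theorem hasSquareGridPropertyGM_triIsoradialEmbedding : triIsoradialEmbedding.HasSquareGridPropertyGM :=
  squareGridPropertyGM_triIsoradialEmbedding.hasSquareGridPropertyGM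

/-- `𝕋` has the (weaker) H21 square-grid property `HasSquareGridProperty` as well. [cite: GrimmettManolescu2014Isoradial, §4.2] -/
theorem hasSquareGridProperty_triIsoradialEmbedding : triIsoradialEmbedding.HasSquareGridProperty :=
  hasSquareGridPropertyGM_triIsoradialEmbedding.hasSquareGridProperty

end Literature.Probability.LatticeModels

end
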